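import Summits.AnomalousDissipation.AnomalousDissipation.Theorems.SawtoothPulseCascadeK1LocalisedCascadePhaseOneTails

/-!
# K1loc explicit start — helper: SERIES BOOKKEEPING ON `ℤ` («LatticeRays»)

Helper file of the prover lane on the crux `K1LocalisedCascade` (stmt-AnomalousDissipation-19491), route `SawtoothPulseCascade`
(arbiter A24-5 R1; used by `NToothOffLobe`).  Four elementary facts: the telescoping tail `Σ'_{e≥0} 1/(E+e)² ≤ 1/(E−1)`
(with its finite form), the two-ray cover `Σ'_ℤ G ≤ Σ'_{e≥0} G(B+e) + Σ'_{e≥0} G(−(B+e))` for `0 ≤ G` vanishing on `|m| < B`,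
and the reindexing of a series supported on the multiples of `N`.  No definitions; nothing about the crux. [folklore] [problem: turb]
-/

-- `Summit.<Summit>.<Problem>`: single-conjunct summit, the duplicate namespace segment is deliberate.
set_option linter.dupNamespace false

noncomputable section

namespace Summit.AnomalousDissipation.AnomalousDissipation.Theorems.SawtoothPulseCascade.K1Window

open Filter Topology
open scoped Real

/-! ## Summation bookkeeping -/

/-- `Σ_{e<M} 1/(E+e)² ≤ 1/(E−1) − 1/(E+M−1)` (`E ≥ 2`), by telescoping. [folklore] -/
theorem sum_range_inv_sq_shift_le {E : ℕ} (hE : 2 ≤ E) (M : ℕ) :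
    ∑ e ∈ Finset.range M, 1 / (((E : ℝ) + e) ^ 2) ≤ 1 / ((E : ℝ) - 1) - 1 / ((E : ℝ) + M - 1) := by
  have hE' : (2 : ℝ) ≤ E := by exact_mod_cast hE
  induction M with
  | zero => simp
  | succ M ih =>
    rw [Finset.sum_range_succ]
    have hx : (1 : ℝ) ≤ (E : ℝ) + M - 1 := by have : (0 : ℝ) ≤ M := Nat.cast_nonneg M; linarith
    have step : 1 / (((E : ℝ) + (M : ℕ)) ^ 2) ≤ 1 / ((E : ℝ) + M - 1) - 1 / ((E : ℝ) + ((M + 1 : ℕ) : ℝ) - 1) := by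
      push_cast
      rw [show (E : ℝ) + (M + 1) - 1 = (E : ℝ) + M by ring]
      rw [div_sub_div _ _ (by linarith) (by linarith), div_le_div_iff₀ (by positivity) (by nlinarith)]
      nlinarith
    push_cast at ih step ⊢
    linarith

/-- `Σ'_{e≥0} 1/(E+e)² ≤ 1/(E−1)` (`E ≥ 2`). [folklore] -/
theorem tsum_inv_sq_shift_le {E : ℕ} (hE : 2 ≤ E) :
    ∑' e : ℕ, 1 / (((E : ℝ) + e) ^ 2) ≤ 1 / ((E : ℝ) - 1) := by
  have hE' : (2 : ℝ) ≤ E := by exact_mod_cast hE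
  refine Real.tsum_le_of_sum_range_le (fun e => by positivity) fun M => ?_
  refine (sum_range_inv_sq_shift_le hE M).trans ?_
  have hx : (0 : ℝ) < (E : ℝ) + M - 1 := by have : (0 : ℝ) ≤ M := Nat.cast_nonneg M; linarith
  have : 0 ≤ 1 / ((E : ℝ) + M - 1) := by positivity
  linarith

/-- **Two-ray cover of `ℤ`**: if `0 ≤ G` is summable and vanishes on `|m| < B`, then
`Σ'_m G(m) ≤ Σ'_{e≥0} G(B+e) + Σ'_{e≥0} G(−(B+e))`. [folklore] -/
theorem tsum_le_tsum_rays {G : ℤ → ℝ} (hG0 : ∀ m, 0 ≤ G m) (hGs : Summable G) (B : ℕ)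
    (hB : ∀ m : ℤ, |m| < B → G m = 0) :
    ∑' m : ℤ, G m ≤ ∑' e : ℕ, G ((B : ℤ) + e) + ∑' e : ℕ, G (-((B : ℤ) + e)) := by
  classical
  set Gp : ℤ → ℝ := fun m => if (B : ℤ) ≤ m then G m else 0 with hGp
  set Gm : ℤ → ℝ := fun m => if m ≤ -(B : ℤ) then G m else 0 with hGm
  have hle : ∀ m, G m ≤ Gp m + Gm m := by
    intro m
    simp only [hGp, hGm]
    by_cases h1 : (B : ℤ) ≤ m
    · rw [if_pos h1]; split_ifs <;> linarith [hG0 m]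
    · rw [if_neg h1]
      by_cases h2 : m ≤ -(B : ℤ)
      · rw [if_pos h2]; linarith
      · rw [if_neg h2, hB m (by rw [abs_lt]; omega)]; linarith
  have hGp_s : Summable Gp := Summable.of_nonneg_of_le (fun m => by simp only [hGp]; split_ifs; exacts [hG0 m, le_rfl])
    (fun m => by simp only [hGp]; split_ifs; exacts [le_rfl, hG0 m]) hGs
  have hGm_s : Summable Gm := Summable.of_nonneg_of_le (fun m => by simp only [hGm]; split_ifs; exacts [hG0 m, le_rfl])
    (fun m => by simp only [hGm]; split_ifs; exacts [le_rfl, hG0 m]) hGs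
  have h1 : ∑' m, G m ≤ ∑' m, (Gp m + Gm m) := Summable.tsum_le_tsum hle hGs (hGp_s.add hGm_s)
  rw [hGp_s.tsum_add hGm_s] at h1
  -- the two rays as injective images
  have hinjp : Function.Injective (fun e : ℕ => (B : ℤ) + e) := fun a b h => by simpa using h
  have hinjm : Function.Injective (fun e : ℕ => -((B : ℤ) + e)) := fun a b h => by simpa using h
  have hsp : Function.support Gp ⊆ Set.range (fun e : ℕ => (B : ℤ) + e) := by
    intro m hm
    rw [Function.mem_support] at hm
    have h : (B : ℤ) ≤ m := by by_contra h; exact hm (by simp [hGp, h])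
    exact ⟨(m - B).toNat, by simp only; omega⟩
  have hsm : Function.support Gm ⊆ Set.range (fun e : ℕ => -((B : ℤ) + e)) := by
    intro m hm
    rw [Function.mem_support] at hm
    have h : m ≤ -(B : ℤ) := by by_contra h; exact hm (by simp [hGm, h])
    exact ⟨(-m - B).toNat, by simp only; omega⟩
  have ep : ∑' m, Gp m = ∑' e : ℕ, G ((B : ℤ) + e) := by
    rw [← hinjp.tsum_eq hsp]
    refine tsum_congr fun e => ?_
    simp only [hGp]
    rw [if_pos (by omega)]
  have em : ∑' m, Gm m = ∑' e : ℕ, G (-((B : ℤ) + e)) := by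
    rw [← hinjm.tsum_eq hsm]
    refine tsum_congr fun e => ?_
    simp only [hGm]
    rw [if_pos (by omega)]
  rw [ep, em] at h1
  exact h1

/-- **Series supported on multiples of `N`**: if `G(m) = 0` unless `N ∣ m` (`N ≥ 1`), then `Σ'_m G(m) = Σ'_j G(Nj)`. [folklore] -/
theorem tsum_eq_tsum_multiples {G : ℤ → ℝ} {N : ℕ} (hN : 0 < N) (hG : ∀ m : ℤ, ¬ (N : ℤ) ∣ m → G m = 0) :
    ∑' m : ℤ, G m = ∑' j : ℤ, G ((N : ℤ) * j) := by
  have hinj : Function.Injective (fun j : ℤ => (N : ℤ) * j) :=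
    mul_right_injective₀ (by exact_mod_cast hN.ne')
  have hsupp : Function.support G ⊆ Set.range (fun j : ℤ => (N : ℤ) * j) := by
    intro m hm
    rw [Function.mem_support] at hm
    have hd : (N : ℤ) ∣ m := by by_contra h; exact hm (hG m h)
    obtain ⟨j, rfl⟩ := hd
    exact ⟨j, rfl⟩
  exact (hinj.tsum_eq hsupp).symm

end Summit.AnomalousDissipation.AnomalousDissipation.Theorems.SawtoothPulseCascade.K1Window
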